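import Mathlib
import Literature.NumberTheory.LFunctions.KloostermanPrimePower
import Literature.NumberTheory.Sieve.LargeSieveCharacters
import Literature.NumberTheory.GaussSums.AdditiveCharacterExpansion

/-!
# Zhang (2022), rung F-S3 (Landau–Siegel programme, §D edge len = E*-len⁺): route `ZDegreeToeplitzBand` —
# prime-modulus `Kl₂` identities of the M-RULEBOOK: the x-SUM COLLAPSE (§5′ (E4.q2)(1), via Ramanujan sums) and the
# CHARACTER EXPANSION `S(a,1;p) = (p−1)⁻¹ Σ_θ θ̄(a) τ(θ)²` with its ℓ¹-weight count (§5′ (E4.z′))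

For a prime `p`, `ψ = e(·/p)` (`ZMod.stdAddChar`), the classical Kloosterman sum
`S(a,b;p) = Σ_{y ≢ 0} ψ(a y + b ȳ)` (tree: `Literature.NumberTheory.LFunctions.kloostermanSum p a b`, Iwaniec,
*Spectral methods* §2.5 (2.23)) and `c, n₂ ≢ 0 (mod p)`:

  `Σ_{x ≢ 0 (mod p)} ψ(x̄) · S(c x̄, n₂; p) = p · ψ(−n₂ c) + 1`   (`kloostermanSum_collapse`).

Proof: swap the sums; `Σ_{x ≢ 0} ψ(x̄ (1 + c y))` is the Ramanujan sum `c_p(1 + c y)` (Montgomery–Vaughan Thm 4.1 (4.7):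
`= p − 1` at `y ≡ −c̄`, else `−1`), and `Σ_{y ≢ 0} ψ(n₂ ȳ) = −1`.

Part 2 (M-RULEBOOK §5′ (E4.z′), theory g3 08:19:15Z (b2)): the `Kl₂` CHARACTER EXPANSION over the `p − 1` Dirichlet characters
`θ (mod p)` — `Σ_θ θ(ā) τ(θ)² = (p − 1)·S(1,a;p)` (`sum_char_inv_mul_gaussSum_sq`, from orthogonality MV Cor 4.5 (4.15)), i.e.
`S(a,1;p) = (p−1)⁻¹ Σ_θ θ̄(a) τ(θ)²` (`kloostermanSum_eq_inv_mul_sum_char`, with `S(a,b;p) = S(b,a;p)`), and its WEIGHTS: the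
principal term has absolute value `1` (`τ(θ₀) = −1`, tree `Literature.NumberTheory.GaussSums.gaussSum_one_stdAddChar`), each of the `p − 2` non-principal terms has absolute value `p`
(`|τ(θ)|² = p`, MV Thm 9.7 — every non-principal character mod a prime is primitive, MV §9.1), so the ℓ¹ mass is
`1 + (p − 2)p ≍ p²` against the normaliser `p − 1` (`sum_norm_char_inv_mul_gaussSum_sq`): the route «multiply out `τ(ψ̄)²`,
expand `Kl₂` over `θ`, bound every non-principal `θ`» is CLOSED BY COUNTING (weight ratio `≍ p` per character), as the
rulebook records.

WHY (cell landau-siegel §D, E₀-free rung; theory/M-RULEBOOK.md v0.5–v0.7 §5′ (E4.q2) «the checked Kl₂-Voronoi count», item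
(1) x-SUM COLLAPSE; ls-knife-crit-1 g5 desk kernel `KlCollapse-ZDegreeToeplitzBand.lean` v2 sha16 1a40e54a356ed548, checked
by ls-theory g3/g4 08:01:57Z / 08:30Z): on the multiplied-out route for a `Kl₂` half of a degree-±1 slot of the ψ-graded Gram
table, after the `x`-sum against `ψ(x̄)` the GL(3)-Voronoi dual terms become COHERENT — the `x`-independent exact class is
multiplied by `Σ_{x ≢ 0} ψ(x̄) = −1` while the dual block acquires the explicit additive phase `ψ(−n₂ c)` at size `p` — which is
why a VORONOI LEDGER (M-RULEBOOK §6 (D3)) must cite this identity with its conditions `p ∤ c`, `p ∤ n₂`. This file is the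
tree form of the desk kernel (namespace moved under the route's `KnifeEdge`; the desk's local `kloosterman` def replaced by the
tree's `kloostermanSum` through the bridge `kloostermanSum_eq_sum_erase_zero`, so NO new definition is introduced).

**WHAT THIS IS NOT: not a claim about Theorems 1–2 of arXiv:2211.02515, about Landau–Siegel zeros, or about Parity. The
programme SEARCHES and TYPES; no claim about Landau–Siegel zeros, Theorems 1–2 of arXiv:2211.02515 or a repaired Margin232
until a kernel theorem says so.** No table of the route is evaluated here; the identity is finite-field character algebra.

Typer: ls-knife-typer-3 g8 (WAKE ls-lead g3 08:16:01Z (3); theory g3 08:19:15Z (b1); crit-1 g5 08:19:44Z (i)); kernel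
author ls-knife-crit-1 g5.

## References
* H. Iwaniec, *Spectral Methods of Automorphic Forms*, 2nd ed., AMS GSM 53 (2002), §2.5: the classical Kloosterman sum
  (2.23)–(2.25) and the Ramanujan sum (2.26) `S(m,0;c) = Σ*_{d (c)} e(dm/c) = Σ_{δ | (c,m)} μ(c/δ) δ` — read on the page
  (lit store `book:iwaniecnd-spectral-methods-automorphic-forms`, chunk p0035). [cite: Iwaniec2002, §2.5 (2.26)]
* H. L. Montgomery, R. C. Vaughan, *Multiplicative Number Theory I*, CUP (2007): Thm 4.1 (4.7) (Ramanujan's sum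
  `c_q(n) = Σ_{d | (q,n)} d μ(q/d)`, `Σ_{(a,q)=1} e(a/q) = μ(q)`), Cor 4.5 (4.14)–(4.15) (there are `φ(q)` characters;
  orthogonality), §9.1 (after Lemma 9.3: at a prime modulus a character is primitive iff non-principal), Thm 9.7
  (`|τ(χ)| = √q` for primitive `χ`) — read on the page (lit store `book:montgomery2007-multiplicative-number-theory-i-…`,
  chunks p0092 / p0096–p0097 / p0218 / p0221). [cite: MontgomeryVaughan2007, Thm 4.1 (4.7), Cor 4.5 (4.15), §9.1, Thm 9.7]
* Y. Zhang, arXiv:2211.02515v1 (2022), §7 (7.9)–(7.11), §14 (14.3)–(14.4) (where the `p`-family phases of the graded cells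
  arise). [cite: Zhang2022LandauSiegel, §14 (14.3)–(14.4)]
-/

noncomputable section

open Finset

namespace Literature.NumberTheory.LFunctions.Zhang2022.KnifeEdge

variable {p : ℕ} [Fact p.Prime]

/-- **Ramanujan sum at a prime, over the nonzero residues:** `Σ_{x ≢ 0 (p)} ψ(x t) = [t ≡ 0]·p − 1` (`= c_p(t)`:
`p − 1` if `p ∣ t`, else `−1`; Montgomery–Vaughan (4.7) / Iwaniec (2.26) with `c = p`). [cite: MontgomeryVaughan2007, Thm 4.1 (4.7)] -/
theorem sum_erase_zero_stdAddChar_mul (t : ZMod p) :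
    ∑ x ∈ (univ : Finset (ZMod p)).erase 0, ZMod.stdAddChar (x * t)
      = (if t = 0 then (p : ℂ) else 0) - 1 := by
  classical
  rw [Finset.sum_erase_eq_sub (Finset.mem_univ _), zero_mul, AddChar.map_zero_eq_one,
    AddChar.sum_mulShift t (ZMod.isPrimitive_stdAddChar p), ZMod.card]
  split_ifs <;> simp

/-- The same with the inverse variable: `Σ_{x ≢ 0} ψ(x̄ t) = [t ≡ 0]·p − 1` (`x ↦ x̄` permutes the nonzero residues of the
field `ℤ/p`). [cite: MontgomeryVaughan2007, Thm 4.1 (4.7)] -/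
theorem sum_erase_zero_stdAddChar_inv_mul (t : ZMod p) :
    ∑ x ∈ (univ : Finset (ZMod p)).erase 0, ZMod.stdAddChar (x⁻¹ * t)
      = (if t = 0 then (p : ℂ) else 0) - 1 := by
  classical
  rw [← sum_erase_zero_stdAddChar_mul t]
  refine Finset.sum_nbij' (fun x => x⁻¹) (fun x => x⁻¹) ?_ ?_ ?_ ?_ ?_
  · intro x hx
    rw [mem_erase] at hx ⊢
    exact ⟨inv_ne_zero hx.1, mem_univ _⟩
  · intro x hx
    rw [mem_erase] at hx ⊢
    exact ⟨inv_ne_zero hx.1, mem_univ _⟩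
  · intro x _
    exact inv_inv x
  · intro x _
    exact inv_inv x
  · intro x _
    rfl

/-- **Bridge to the tree's Kloosterman sum at a prime modulus:** `kloostermanSum p a b` (a sum over `ℤ/p` with the
non-units omitted) is the sum of `ψ(a y + b ȳ)` over the nonzero residues of the field `ℤ/p` (`ȳ` the field inverse).
[cite: Iwaniec2002, §2.5 (2.23)–(2.25)] -/
theorem kloostermanSum_eq_sum_erase_zero (a b : ZMod p) :
    Literature.NumberTheory.LFunctions.kloostermanSum p a b =
      ∑ y ∈ (univ : Finset (ZMod p)).erase 0, ZMod.stdAddChar (a * y + b * y⁻¹) := by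
  classical
  unfold Literature.NumberTheory.LFunctions.kloostermanSum
  rw [← Finset.sum_filter]
  exact Finset.sum_congr (by ext x; simp [isUnit_iff_ne_zero]) fun _ _ => rfl

/-- **x-SUM COLLAPSE (M-RULEBOOK §5′ (E4.q2)(1); desk kernel ls-knife-crit-1 g5 v2 1a40e54a356ed548, checked by ls-theory):**
for a prime `p` and `c, n₂ ≢ 0 (mod p)`,
`Σ_{x ≢ 0 (mod p)} ψ(x̄) · S(c x̄, n₂; p) = p · ψ(−n₂ c) + 1`, `S = kloostermanSum p`, `ψ = e(·/p)`.
Swap the sums: `ψ(x̄)ψ(c x̄ y + n₂ ȳ) = ψ(n₂ ȳ)·ψ(x̄(1 + c y))`, the `x`-sum is the Ramanujan sum `c_p(1 + c y)` (`p − 1` at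
`y = −c̄`, else `−1`), and `Σ_{y ≢ 0} ψ(n₂ ȳ) = −1`. [cite: MontgomeryVaughan2007, Thm 4.1 (4.7)] -/
theorem kloostermanSum_collapse (c n₂ : ZMod p) (hc : c ≠ 0) (hn : n₂ ≠ 0) :
    ∑ x ∈ (univ : Finset (ZMod p)).erase 0,
        ZMod.stdAddChar x⁻¹ * Literature.NumberTheory.LFunctions.kloostermanSum p (c * x⁻¹) n₂
      = (p : ℂ) * ZMod.stdAddChar (-(n₂ * c)) + 1 := by
  classical
  simp_rw [kloostermanSum_eq_sum_erase_zero]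
  set E := (univ : Finset (ZMod p)).erase 0 with hE
  -- regroup the phase: ψ(x̄) ψ(c x̄ y + n₂ ȳ) = ψ(n₂ ȳ) ψ(x̄ (1 + c y))
  have h1 : ∀ x y : ZMod p, ZMod.stdAddChar x⁻¹ * ZMod.stdAddChar (c * x⁻¹ * y + n₂ * y⁻¹)
      = ZMod.stdAddChar (n₂ * y⁻¹) * ZMod.stdAddChar (x⁻¹ * (1 + c * y)) := by
    intro x y
    rw [← AddChar.map_add_eq_mul, ← AddChar.map_add_eq_mul]
    congr 1
    ring
  -- the Ramanujan-sum switch: 1 + c y ≡ 0 ↔ y ≡ −c̄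
  have h2 : ∀ y : ZMod p, (if 1 + c * y = 0 then (p : ℂ) else 0) = if y = -c⁻¹ then (p : ℂ) else 0 := by
    intro y
    by_cases hy : y = -c⁻¹
    · rw [if_pos hy, if_pos (by rw [hy, mul_neg, mul_inv_cancel₀ hc, add_neg_cancel])]
    · rw [if_neg hy, if_neg]
      intro h
      apply hy
      have hcy : c * y = -1 := by linear_combination h
      calc y = c⁻¹ * (c * y) := by rw [← mul_assoc, inv_mul_cancel₀ hc, one_mul]
        _ = -c⁻¹ := by rw [hcy, mul_neg, mul_one]
  have hmem : (-c⁻¹ : ZMod p) ∈ E := by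
    rw [hE, mem_erase]
    exact ⟨neg_ne_zero.mpr (inv_ne_zero hc), mem_univ _⟩
  have hA : ∑ y ∈ E, ZMod.stdAddChar (n₂ * y⁻¹) * (if y = -c⁻¹ then (p : ℂ) else 0)
      = (p : ℂ) * ZMod.stdAddChar (-(n₂ * c)) := by
    simp_rw [mul_ite, mul_zero]
    rw [Finset.sum_ite_eq' E (-c⁻¹), if_pos hmem, neg_inv, inv_inv, mul_neg]
    ring
  have hB : ∑ y ∈ E, ZMod.stdAddChar (n₂ * y⁻¹) = -1 := by
    simp_rw [mul_comm n₂]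
    rw [sum_erase_zero_stdAddChar_inv_mul, if_neg hn, zero_sub]
  calc ∑ x ∈ E, ZMod.stdAddChar x⁻¹ * ∑ y ∈ E, ZMod.stdAddChar (c * x⁻¹ * y + n₂ * y⁻¹)
      = ∑ x ∈ E, ∑ y ∈ E, ZMod.stdAddChar (n₂ * y⁻¹) * ZMod.stdAddChar (x⁻¹ * (1 + c * y)) := by
        refine sum_congr rfl fun x _ => ?_
        rw [mul_sum]
        exact sum_congr rfl fun y _ => h1 x y
    _ = ∑ y ∈ E, ZMod.stdAddChar (n₂ * y⁻¹) * ∑ x ∈ E, ZMod.stdAddChar (x⁻¹ * (1 + c * y)) := by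
        rw [sum_comm]
        exact sum_congr rfl fun y _ => by rw [mul_sum]
    _ = ∑ y ∈ E, ZMod.stdAddChar (n₂ * y⁻¹) * ((if y = -c⁻¹ then (p : ℂ) else 0) - 1) := by
        exact sum_congr rfl fun y _ => by rw [sum_erase_zero_stdAddChar_inv_mul, h2 y]
    _ = ∑ y ∈ E, ZMod.stdAddChar (n₂ * y⁻¹) * (if y = -c⁻¹ then (p : ℂ) else 0)
          - ∑ y ∈ E, ZMod.stdAddChar (n₂ * y⁻¹) := by
        rw [← sum_sub_distrib]
        exact sum_congr rfl fun y _ => by ring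
    _ = (p : ℂ) * ZMod.stdAddChar (-(n₂ * c)) + 1 := by
        rw [hA, hB]
        ring

/-- `Σ_{x ≢ 0} ψ(x̄) = μ(p) = −1` — the factor by which the `x`-sum multiplies an `x`-independent exact class
(M-RULEBOOK (E4.q2)(2)). [cite: MontgomeryVaughan2007, Thm 4.1 (4.7)] -/
theorem sum_erase_zero_stdAddChar_inv :
    ∑ x ∈ (univ : Finset (ZMod p)).erase 0, ZMod.stdAddChar x⁻¹ = (-1 : ℂ) := by
  have h := sum_erase_zero_stdAddChar_inv_mul (p := p) 1
  simp_rw [mul_one] at h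
  rw [h, if_neg one_ne_zero, zero_sub]

/-! ### Part 2 — the Kl₂ CHARACTER EXPANSION (M-RULEBOOK §5′ (E4.z′)) and its weights -/

section CharExpansion

open DirichletCharacter

/-- `S(a,b;p) = S(b,a;p)` (`y ↦ ȳ` permutes the nonzero residues). [cite: Iwaniec2002, §2.5 (2.23)–(2.25)] -/
theorem kloostermanSum_comm (a b : ZMod p) :
    Literature.NumberTheory.LFunctions.kloostermanSum p a b = Literature.NumberTheory.LFunctions.kloostermanSum p b a := by
  classical
  rw [kloostermanSum_eq_sum_erase_zero, kloostermanSum_eq_sum_erase_zero]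
  refine Finset.sum_nbij' (fun x => x⁻¹) (fun x => x⁻¹) ?_ ?_ ?_ ?_ ?_
  · intro x hx
    rw [mem_erase] at hx ⊢
    exact ⟨inv_ne_zero hx.1, mem_univ _⟩
  · intro x hx
    rw [mem_erase] at hx ⊢
    exact ⟨inv_ne_zero hx.1, mem_univ _⟩
  · intro x _
    exact inv_inv x
  · intro x _
    exact inv_inv x
  · intro x _
    simp only [inv_inv]
    rw [add_comm]

/-- Orthogonality of the `p − 1` Dirichlet characters mod a prime `p`, in the form used here: for `a ≢ 0`,
`Σ_θ θ(ā) θ(b) = (p − 1)·[a = b]`. [cite: MontgomeryVaughan2007, Cor 4.5 (4.15)] -/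
theorem sum_char_inv_mul_char_eq_prime {a : ZMod p} (ha : a ≠ 0) (b : ZMod p) :
    ∑ θ : DirichletCharacter ℂ p, θ a⁻¹ * θ b = if a = b then ((p : ℂ) - 1) else 0 := by
  rw [DirichletCharacter.sum_char_inv_mul_char_eq ℂ (isUnit_iff_ne_zero.2 ha) b,
    Nat.totient_prime (Fact.out : p.Prime), Nat.cast_sub (Fact.out : p.Prime).one_le, Nat.cast_one]

/-- **Kl₂ CHARACTER EXPANSION (M-RULEBOOK §5′ (E4.z′)):** for a prime `p` and `a ≢ 0 (mod p)`,
`Σ_{θ mod p} θ(ā) τ(θ)² = (p − 1) · S(1, a; p)` with `τ(θ) = Σ_x θ(x) e(x/p)` (Mathlib `gaussSum θ ZMod.stdAddChar`) and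
`S = kloostermanSum p`; i.e. `S(a,1;p) = S(1,a;p) = (1/(p−1)) Σ_θ θ̄(a) τ(θ)²`. Proof: `τ(θ)² = Σ_{x,y} θ(xy)ψ(x+y)`, swap,
orthogonality pins `xy = a`. [cite: MontgomeryVaughan2007, Cor 4.5 (4.15)] -/
theorem sum_char_inv_mul_gaussSum_sq {a : ZMod p} (ha : a ≠ 0) :
    ∑ θ : DirichletCharacter ℂ p, θ a⁻¹ * gaussSum θ (ZMod.stdAddChar (N := p)) ^ 2
      = ((p : ℂ) - 1) * Literature.NumberTheory.LFunctions.kloostermanSum p 1 a := by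
  classical
  set ψ : AddChar (ZMod p) ℂ := ZMod.stdAddChar with hψ
  -- expand τ(θ)² = Σ_{x,y} θ(x y) ψ(x + y)
  have hsq : ∀ θ : DirichletCharacter ℂ p, θ a⁻¹ * gaussSum θ ψ ^ 2 =
      ∑ x : ZMod p, ∑ y : ZMod p, ψ (x + y) * (θ a⁻¹ * θ (x * y)) := by
    intro θ
    rw [sq, gaussSum, Finset.sum_mul_sum, Finset.mul_sum]
    refine Finset.sum_congr rfl fun x _ => ?_
    rw [Finset.mul_sum]
    refine Finset.sum_congr rfl fun y _ => ?_
    rw [map_mul, AddChar.map_add_eq_mul]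
    ring
  -- the inner y-sum after orthogonality
  have hy : ∀ x : ZMod p, ∑ y : ZMod p, ψ (x + y) * (if a = x * y then ((p : ℂ) - 1) else 0)
      = if x = 0 then 0 else ((p : ℂ) - 1) * ψ (x + a * x⁻¹) := by
    intro x
    by_cases hx : x = 0
    · rw [if_pos hx]
      refine Finset.sum_eq_zero fun y _ => ?_
      rw [if_neg, mul_zero]
      rw [hx, zero_mul]
      exact ha
    · rw [if_neg hx]
      have hiff : ∀ y : ZMod p, (a = x * y) ↔ (y = a * x⁻¹) := by
        intro y
        constructor
        · intro h
          rw [h, mul_comm x y, mul_assoc, mul_inv_cancel₀ hx, mul_one]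
        · intro h
          rw [h, mul_comm a, ← mul_assoc, mul_inv_cancel₀ hx, one_mul]
      simp_rw [hiff, mul_ite, mul_zero]
      rw [Finset.sum_ite_eq' univ (a * x⁻¹) (fun y => ψ (x + y) * ((p : ℂ) - 1)), if_pos (mem_univ _)]
      ring
  calc ∑ θ : DirichletCharacter ℂ p, θ a⁻¹ * gaussSum θ ψ ^ 2
      = ∑ θ : DirichletCharacter ℂ p, ∑ x : ZMod p, ∑ y : ZMod p, ψ (x + y) * (θ a⁻¹ * θ (x * y)) :=
        Finset.sum_congr rfl fun θ _ => hsq θ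
    _ = ∑ x : ZMod p, ∑ y : ZMod p, ∑ θ : DirichletCharacter ℂ p, ψ (x + y) * (θ a⁻¹ * θ (x * y)) := by
        rw [Finset.sum_comm]
        exact Finset.sum_congr rfl fun x _ => Finset.sum_comm
    _ = ∑ x : ZMod p, ∑ y : ZMod p, ψ (x + y) * (if a = x * y then ((p : ℂ) - 1) else 0) := by
        refine Finset.sum_congr rfl fun x _ => Finset.sum_congr rfl fun y _ => ?_
        rw [← Finset.mul_sum, sum_char_inv_mul_char_eq_prime ha]
    _ = ∑ x : ZMod p, (if x = 0 then 0 else ((p : ℂ) - 1) * ψ (x + a * x⁻¹)) :=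
        Finset.sum_congr rfl fun x _ => hy x
    _ = ∑ x ∈ (univ : Finset (ZMod p)).erase 0, ((p : ℂ) - 1) * ψ (1 * x + a * x⁻¹) := by
        rw [← Finset.sum_erase (univ : Finset (ZMod p)) (a := 0) (by rw [if_pos rfl])]
        refine Finset.sum_congr rfl fun x hx => ?_
        rw [if_neg (mem_erase.1 hx).1, one_mul]
    _ = ((p : ℂ) - 1) * Literature.NumberTheory.LFunctions.kloostermanSum p 1 a := by
        rw [kloostermanSum_eq_sum_erase_zero, Finset.mul_sum]

/-- … solved for the Kloosterman sum: `S(a,1;p) = (p − 1)⁻¹ Σ_θ θ(ā) τ(θ)²` (`a ≢ 0`). [cite: MontgomeryVaughan2007, Cor 4.5 (4.15)] -/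
theorem kloostermanSum_eq_inv_mul_sum_char {a : ZMod p} (ha : a ≠ 0) :
    Literature.NumberTheory.LFunctions.kloostermanSum p a 1 =
      ((p : ℂ) - 1)⁻¹ * ∑ θ : DirichletCharacter ℂ p, θ a⁻¹ * gaussSum θ (ZMod.stdAddChar (N := p)) ^ 2 := by
  have hp : ((p : ℂ) - 1) ≠ 0 := by
    have h2 := (Fact.out : p.Prime).two_le
    exact_mod_cast (show ((p : ℂ) - 1) ≠ 0 from sub_ne_zero.2 (by exact_mod_cast (by omega : p ≠ 1)))
  rw [sum_char_inv_mul_gaussSum_sq ha, ← mul_assoc, inv_mul_cancel₀ hp, one_mul, kloostermanSum_comm]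

/-- At a PRIME level every non-principal character is primitive (its conductor divides `p` and is not `1`).
[cite: MontgomeryVaughan2007, §9.1 (after Lemma 9.3)] -/
theorem isPrimitive_of_ne_one {θ : DirichletCharacter ℂ p} (hθ : θ ≠ 1) : θ.IsPrimitive := by
  rw [isPrimitive_def]
  rcases (Fact.out : p.Prime).eq_one_or_self_of_dvd _ (conductor_dvd_level θ) with h | h
  · exact absurd (eq_one_iff_conductor_eq_one.2 h) hθ
  · exact h

/-- **Weight of a non-principal character:** `|τ(θ)|² = p` for `θ ≠ θ₀` mod a prime `p`. [cite: MontgomeryVaughan2007, Thm 9.7] -/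
theorem norm_gaussSum_sq_of_ne_one {θ : DirichletCharacter ℂ p} (hθ : θ ≠ 1) :
    ‖gaussSum θ (ZMod.stdAddChar (N := p))‖ ^ 2 = p :=
  Literature.NumberTheory.Sieve.LargeSieve.norm_gaussSum_sq (isPrimitive_of_ne_one hθ)

/-- `|θ(ā)| = 1` for `a ≢ 0`. [cite: MontgomeryVaughan2007, Cor 4.5 (4.15)] -/
theorem norm_char_inv_eq_one (θ : DirichletCharacter ℂ p) {a : ZMod p} (ha : a ≠ 0) : ‖θ a⁻¹‖ = 1 := by
  obtain ⟨u, hu⟩ := isUnit_iff_ne_zero.2 (inv_ne_zero ha)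
  rw [← hu]
  exact θ.unit_norm_eq_one u

/-- **The ℓ¹-weight count of the character expansion (M-RULEBOOK (E4.z′): «principal `1/(p−1)`, non-principal `p/(p−1)`»):**
in `Σ_θ θ(ā) τ(θ)²` the principal term has absolute value `1` and each of the `p − 2` non-principal terms has absolute value
`p`, so the ℓ¹ mass is `1 + (p − 2)·p ≍ p²` against the normaliser `p − 1` of the exact class — weight ratio `≍ p` per
character, which is why the route «expand `Kl₂` over `θ` and bound every non-principal `θ`» is closed by counting.
[cite: MontgomeryVaughan2007, Thm 9.7] -/
theorem norm_char_inv_mul_gaussSum_sq {θ : DirichletCharacter ℂ p} {a : ZMod p} (ha : a ≠ 0) :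
    ‖θ a⁻¹ * gaussSum θ (ZMod.stdAddChar (N := p)) ^ 2‖ = if θ = 1 then 1 else (p : ℝ) := by
  rw [norm_mul, norm_char_inv_eq_one θ ha, one_mul, norm_pow]
  split_ifs with h
  · rw [h, Literature.NumberTheory.GaussSums.gaussSum_one_stdAddChar]; simp
  · exact norm_gaussSum_sq_of_ne_one h

/-- There are `p − 1` Dirichlet characters mod a prime `p`. [cite: MontgomeryVaughan2007, Cor 4.5 (4.15)] -/
theorem card_dirichletCharacter_prime : Fintype.card (DirichletCharacter ℂ p) = p - 1 := by
  rw [← Nat.card_eq_fintype_card, DirichletCharacter.card_eq_totient_of_hasEnoughRootsOfUnity ℂ p,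
    Nat.totient_prime (Fact.out : p.Prime)]

/-- **Total ℓ¹ mass of the expansion:** `Σ_θ |θ(ā) τ(θ)²| = 1 + (p − 2)·p` for `a ≢ 0`. [cite: MontgomeryVaughan2007, Thm 9.7] -/
theorem sum_norm_char_inv_mul_gaussSum_sq {a : ZMod p} (ha : a ≠ 0) :
    ∑ θ : DirichletCharacter ℂ p, ‖θ a⁻¹ * gaussSum θ (ZMod.stdAddChar (N := p)) ^ 2‖ = 1 + ((p : ℝ) - 2) * p := by
  classical
  simp_rw [norm_char_inv_mul_gaussSum_sq ha]
  rw [Finset.sum_ite, Finset.sum_const, Finset.sum_const, Finset.filter_eq', if_pos (mem_univ _), card_singleton,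
    Finset.filter_ne', Finset.card_erase_of_mem (mem_univ _), Finset.card_univ, card_dirichletCharacter_prime]
  have h2 := (Fact.out : p.Prime).two_le
  rw [nsmul_eq_mul, nsmul_eq_mul, Nat.cast_sub (by omega : 1 ≤ p - 1), Nat.cast_sub (by omega : 1 ≤ p)]
  push_cast
  ring

end CharExpansion

end Literature.NumberTheory.LFunctions.Zhang2022.KnifeEdge

end
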